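import Summits.QuantumFields.YangMills.Theses.SlackWindow
import Summits.QuantumFields.YangMills.Theorems.ThermodynamicCeilingsMirrorMonotoneDecay
import HarnessLib

/-!
# Route `SlackWindow`, crux `CarrierSlackLargeMirrorCeiling` (stmt-QuantumFields-23686), LINE 1 «PlancherelCovering»
# (planner ym-idea-11 g12, skeleton baac1d313893): the registered stub `stub_pointToBand` BY NAME AND SIGNATURE

`stub_pointToBand : CarrierPointCeiling → SlackWindow.CarrierSlackLargeMirrorCeiling` — the σ = 0 point ceiling at the doubled packet
height passes to the whole band `t ∈ [2R+2, L]`: on the odd torus the centred on-axis time-mirror covariance `c_L(t)` is `≥ 0` for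
`t ≥ 3` and non-increasing on `[2, L]` (the LANDED `ThermodynamicCeilings.MirrorMonotoneDecay`,
`Theorems.MirrorMonotoneDecay.mirrorMonotoneDecay_proof`, `0 ≤ β`), so for `t ∈ [2R+2, L]`, with `t₀ := R` (point `2R+1`) if `δ_q = 1`
and `t₀ := R+1` (point `2R+2`) if `δ_q = 0`, `0 ≤ c_L(t) ≤ c_L(point) ≤ (C/R⁴)²`; `σ := 0`, `β₄ := max β₄ 0`.  The name-keyed statements
(`CarrierPointCeiling`, `__Registered.stub_pointToBand`) are reproduced VERBATIM from the skeleton (HOME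
`pub/ideators/ym-idea-11/plancherel-covering.lean`) in this file's own namespace.  Width seat `ym-line-sfw-p2-w4` g19 (cell ym-idea-1;
free hands), `--supports stmt-QuantumFields-23686`.  HONEST FRAMING: bookkeeping; the crux of the line `CarrierWavePacketBound`,
`stub_plancherelCovering`, 23686 and the leaf stay OPEN; no rung or summit; YM mass gap NOT proved. [folklore]
-/

set_option autoImplicit false

namespace Summit.QuantumFields.YangMills.Theorems.SlackWindowPlancherelCovering

open scoped BigOperators Topology Classical MeasureTheory
open Filter Set Function TopologicalSpace MeasureTheory

/-- The σ = 0 POINT ceiling at the doubled packet height (one-sided: an upper bound on the centred on-axis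
time-mirror covariance `c_L(2t₀+δ_q)` for `t₀ ∈ [R, 2R]`, `R·s ≤ ℓ₄`), same prefix as
`SlackWindow.CarrierSlackLargeMirrorCeiling`. -/
def CarrierPointCeiling : Prop :=
  open Literature.MathematicalPhysics.QuantumFieldTheory Literature.MathematicalPhysics.QuantumLattice Summit.QuantumFields.YangMills.Cruxes.OSLegsFromFemtoAndGap.DlrCollarTransfer in ∀ (G : Type) [Group G] [TopologicalSpace G] [IsTopologicalGroup G] [CompactSpace G], IsCompactSimpleLieGroup G → Nonempty (G ≃ₜ* Matrix.specialUnitaryGroup (Fin 2) ℂ) → letI : MeasurableSpace G := borel G; haveI : BorelSpace G := ⟨rfl⟩; ∀ (r : LatticeRep G) (v f g h : SchwartzMap (EuclideanSpace ℝ (Fin 4)) ℝ) (Λ₅ : ℝ), ∃ ε₀ : ℝ, 0 < ε₀ ∧ ∀ ε : ℝ, 0 < ε → ε ≤ ε₀ → (∃ β₅ : ℝ, ∀ β : ℝ, β₅ ≤ β → ∃ s : ℝ, 0 < s ∧ s ≤ 1 ∧ (∀ L : ℕ, Λ₅ ≤ s * L → ε ≤ Q2 G r β L s (thetaTest 4 v)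 v) ∧ (∀ L : ℕ, Λ₅ ≤ s * L → ε ≤ |Q3 G r β L s f g h|)) → ∃ (C ℓ₄ β₄ : ℝ), 0 < ℓ₄ ∧ 0 ≤ C ∧ ∀ β : ℝ, β₄ ≤ β → ∃ L₀ : ℕ, ∀ s : ℝ, 0 < s → s ≤ 1 → (∀ s' : ℝ, 2 * s ≤ s' → s' ≤ 1 → ¬ ((∀ L : ℕ, Λ₅ ≤ s' * L → ε ≤ Q2 G r β L s' (thetaTest 4 v) v) ∧ (∀ L : ℕ, Λ₅ ≤ s' * L → ε ≤ |Q3 G r β L s' f g h|))) → ((∀ L : ℕ, Λ₅ ≤ s * L → ε ≤ Q2 G r β L s (thetaTest 4 v) v) ∧ (∀ L : ℕ, Λ₅ ≤ s * L → ε ≤ |Q3 G r β L s f g h|)) → ∀ (L : ℕ) (q : Fin 4 × Fin 4) (R t₀ : ℕ), q.1 < q.2 → 1 ≤ R → (R : ℝ) * s ≤ ℓ₄ → R ≤ t₀ → t₀ ≤ 2 * R → 4 * R + 8 ≤ L → L₀ ≤ L → let δ : ℤ := if q.1 = 0 then 1 else 0 ; torusE G r β L (fun U => (plane G r q (fun i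 => if i = 0 then (2 * (t₀ : ℤ) + δ) else 0) U - torusE G r β L (plane G r q (fun i => if i = 0 then (2 * (t₀ : ℤ) + δ) else 0))) * (plane G r q (fun _ => 0) U - torusE G r β L (plane G r q (fun _ => 0)))) ≤ (C / (R : ℝ) ^ 4) ^ 2

namespace __Registered

/-- registered stub «PointToBand» (support, S): the point ceiling implies the band ceiling `CarrierSlackLargeMirrorCeiling`
(verbatim the skeleton's `__Registered.stub_pointToBand`). -/
abbrev stub_pointToBand : Prop :=
  CarrierPointCeiling → Summit.QuantumFields.YangMills.Theses.SlackWindow.CarrierSlackLargeMirrorCeiling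

end __Registered

open Literature.MathematicalPhysics.QuantumFieldTheory Literature.MathematicalPhysics.QuantumLattice
open Summit.QuantumFields.YangMills.Cruxes.OSLegsFromFemtoAndGap.DlrCollarTransfer

set_option maxHeartbeats 800000 in
/-- **Registered stub `stub_pointToBand` of LINE 1 «PlancherelCovering»** (crux stmt-QuantumFields-23686), BY NAME AND SIGNATURE:
point ceiling ⇒ band ceiling with `σ = 0`, by monotonicity and non-negativity of the on-axis time-mirror covariance
(`MirrorMonotoneDecay` ✓). [folklore] -/
theorem stub_pointToBand : __Registered.stub_pointToBand := by
  intro hP G _ _ _ _ hG hSU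
  letI : MeasurableSpace G := borel G
  haveI : BorelSpace G := ⟨rfl⟩
  intro r v f g h Λ₅
  obtain ⟨ε₀, hε₀, hmain⟩ := hP G hG hSU r v f g h Λ₅
  refine ⟨ε₀, hε₀, fun ε hε hεε₀ hfloors => ?_⟩
  obtain ⟨C, ℓ₄, β₄, hℓ₄, hC, hβ⟩ := hmain ε hε hεε₀ hfloors
  refine ⟨0, C, ℓ₄, max β₄ 0, hℓ₄, hC, fun β hββ => ?_⟩
  have hβ4 : β₄ ≤ β := (le_max_left _ _).trans hββ
  have hβ0 : 0 ≤ β := (le_max_right _ _).trans hββ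
  obtain ⟨L₀, hL₀⟩ := hβ β hβ4
  refine ⟨L₀, fun s hs hs1 hsel hfl L q R t hq hR hRs hRL hL0 h2R htL => ?_⟩
  -- the on-axis time-mirror covariance as a function of the lattice time
  set c : ℕ → ℝ := fun t => torusE G r β L (fun U => (plane G r q (fun i => if i = 0 then ((t : ℕ) : ℤ) else 0) U -
      torusE G r β L (plane G r q (fun i => if i = 0 then ((t : ℕ) : ℤ) else 0))) *
      (plane G r q (fun _ => 0) U - torusE G r β L (plane G r q (fun _ => 0)))) with hc
  have hMD := Summit.QuantumFields.YangMills.Theorems.MirrorMonotoneDecay.mirrorMonotoneDecay_proof G hG hSU r β L q 0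
  have hstep : ∀ t' : ℕ, 2 ≤ t' → t' + 1 ≤ L → 0 ≤ c (t' + 1) ∧ c (t' + 1) ≤ c t' := fun t' h1 h2 => hMD t' hβ0 hq h1 h2
  have hchain : ∀ m p : ℕ, 2 ≤ p → p + m ≤ L → c (p + m) ≤ c p := by
    intro m
    induction m with
    | zero => intro p _ _; simp
    | succ m ih =>
      intro p hp hpm
      have h1 := (hstep (p + m) (by omega) (by omega)).2
      rw [show p + (m + 1) = p + m + 1 by omega]
      exact h1.trans (ih p hp (by omega))
  have hnonneg : ∀ t' : ℕ, 3 ≤ t' → t' ≤ L → 0 ≤ c t' := by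
    intro t' h1 h2
    obtain ⟨u, rfl⟩ : ∃ u, t' = u + 1 := ⟨t' - 1, by omega⟩
    exact (hstep u (by omega) (by omega)).1
  -- the goal is `|c t| ≤ (C / R⁴ · 1)²`
  show |c t| ≤ (C / (R : ℝ) ^ 4 * (((R : ℝ) * s)⁻¹) ^ 0) ^ 2
  rw [pow_zero, mul_one, abs_of_nonneg (hnonneg t (by omega) htL)]
  by_cases hq0 : q.1 = 0
  · -- `δ_q = 1`: point `2R + 1` (`t₀ := R`)
    have hpt := hL₀ s hs hs1 hsel hfl L q R R hq hR hRs le_rfl (by omega) hRL hL0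
    dsimp only at hpt
    have e : (fun i : Fin 4 => if i = 0 then (2 * (R : ℤ) + (if q.1 = 0 then 1 else 0)) else 0) =
        fun i : Fin 4 => if i = 0 then (((2 * R + 1 : ℕ)) : ℤ) else 0 := by
      funext i; rw [if_pos hq0]; split_ifs
      · push_cast; ring
      · rfl
    rw [e] at hpt
    obtain ⟨m, rfl⟩ : ∃ m, t = (2 * R + 1) + m := ⟨t - (2 * R + 1), by omega⟩
    exact (hchain m (2 * R + 1) (by omega) htL).trans hpt
  · -- `δ_q = 0`: point `2R + 2` (`t₀ := R + 1`)
    have hpt := hL₀ s hs hs1 hsel hfl L q R (R + 1) hq hR hRs (by omega) (by omega) hRL hL0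
    dsimp only at hpt
    have e : (fun i : Fin 4 => if i = 0 then (2 * ((R + 1 : ℕ) : ℤ) + (if q.1 = 0 then 1 else 0)) else 0) =
        fun i : Fin 4 => if i = 0 then (((2 * R + 2 : ℕ)) : ℤ) else 0 := by
      funext i; rw [if_neg hq0]; split_ifs
      · push_cast; ring
      · rfl
    rw [e] at hpt
    obtain ⟨m, rfl⟩ : ∃ m, t = (2 * R + 2) + m := ⟨t - (2 * R + 2), by omega⟩
    exact (hchain m (2 * R + 2) (by omega) htL).trans hpt

end Summit.QuantumFields.YangMills.Theorems.SlackWindowPlancherelCovering
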